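import Summits.Ventures.DiscreteObjects.PP12.FanoFiveOrderFiveCorollaries
import Summits.Ventures.DiscreteObjects.PP12.OrderElevenNoCollineation
import Summits.Ventures.DiscreteObjects.PP12.OrderThirteenNoLift

/-!
# PP(12): Janko–van Trung's `{2,3}`-group theorem as a KERNEL THEOREM (assembly; designs g24)
Framing: lottery ticket; floor = certified bounds/negative ranges.

Cell pub-namedobj (venture DiscreteObjects), target (M). Pure assembly of kernel theorems landed by designs g16–g24:
* `p = 5`: `noOrderFiveOrder12_holds` (`FanoFiveOrderFiveKernel`, designs g18);
* `p = 11`, Case A (homology; fixed antiflag + 11 centre/axis pairs): `Homology12.noHomologyArray12` (`OrderElevenHomologyNoArray`, designs g22);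
* `p = 11`, Case B (fixed triangle): `Triangle12.noTriangleData12` (`OrderElevenTriangleNoData`, designs g23);
* `p = 13`: `noLiftData13` / `noOrderThirteenOrder12` (`OrderThirteenNoLift`, designs g19–g22);
* the reductions `noOrderEleven_of_noCollineationOfOrderEleven` (`OrderElevenReduction`, designs g16) and
  `twoThreeGroup_iff_eleven_thirteen` (`FanoFiveOrderFiveCorollaries`, designs g21), resting on the kernel prime atlas
  `prime_mem_of_collineation_order12` (prime orders of collineations of a projective plane of order 12 lie in `{2, 3, 5, 11, 13}`).
Results (with `noCollineationOfOrderEleven`, `noOrderElevenOrder12_holds` from `OrderElevenNoCollineation`):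
**`collineationGroupIsTwoThreeGroup_holds : CollineationGroupIsTwoThreeGroup`** — the Literature named fact (Janko–van Trung, Geom. Dedicata 12
(1982) 101–110) is DISCHARGED in the kernel: every collineation group of a projective plane of order 12 is a `{2,3}`-group — the corollary
`Collineation.eq_one_of_prime_pow_eq_one` (a collineation `σ` with `σ ^ p = 1`, `p` prime, `p ≠ 2, 3`, is the identity), and the rigid endgame
**`card_collineationGroup_eq_one_v18`**, whose ONLY hypotheses are now the typed finite statements of the live cells `|G| = 2` (`NoLiftableSTD2_12_6`)
and `|G| = 3` (`NoLiftableSTD3_12_4` = order-3 elations, in print Janko–van Trung 1981; the flag sub-cells `NoFlagOrbitMatrix 4`, `NoFlagOrbitMatrix 3`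
(f = 1, 4; UNDECIDED), `NoFlagSevenOrbitMatrix` (f = 7; UNDECIDED), `NoFlagTenOrbitMatrix` (f = 10; EMPTY outside the kernel, two seats)).
Census words: REPLICATION in the kernel of a theorem in print (JvT 1982); no novelty claim; no PP(12) existence / non-existence sentence.
No `sorry`, no new axioms; nothing is asserted beyond the listed kernel theorems.
-/

namespace Summit.Ventures.DiscreteObjects.PP12

open Configuration Literature.Combinatorics.Designs Summit.Ventures.DiscreteObjects.STD

/-- **Janko–van Trung 1982 in the kernel:** every collineation group of a projective plane of order 12 is a `{2,3}`-group
(the Literature named fact `CollineationGroupIsTwoThreeGroup`, discharged). -/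
theorem collineationGroupIsTwoThreeGroup_holds : CollineationGroupIsTwoThreeGroup :=
  twoThreeGroup_iff_eleven_thirteen.2 ⟨noCollineationOfOrderEleven, noLiftData13⟩

/-- **Corollary (single collineations):** a collineation `σ` of a projective plane of order 12 with `σ ^ p = 1` for a prime `p ≠ 2, 3` is the identity
on points. -/
theorem Collineation.eq_one_of_prime_pow_eq_one
    (P L : Type) [Membership P L] [Fintype P] [Fintype L] [ProjectivePlane P L] (h12 : ProjectivePlane.order P L = 12)
    (σ : Collineation P L) {p : ℕ} (hp : p.Prime) (hp2 : p ≠ 2) (hp3 : p ≠ 3) (hq : σ.onPoints ^ p = 1) : σ.onPoints = 1 :=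
  eq_one_of_twoThreeGroup collineationGroupIsTwoThreeGroup_holds P L h12 σ hp hp2 hp3 hq

/-- **Rigid endgame, v18 (cells `p = 5, 11, 13` ALL discharged by the kernel):** the typed finite statements of the live cells `|G| = 2` and `|G| = 3`
alone force every collineation group of a projective plane of order 12 to be trivial. Hypotheses: `h2` involution arrays (liftable STD₂[12;6];
undecided), `h3E` order-3 elation arrays (liftable STD₃[12;4]; in print), `h4, h3` plain flag orbit matrices `ρ = 4, 3` (f = 1, 4; undecided),
`h7` (f = 7; undecided), `h10` (f = 10; EMPTY outside the kernel). -/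
theorem card_collineationGroup_eq_one_v18 (h2 : NoLiftableSTD2_12_6) (h3E : NoLiftableSTD3_12_4)
    (h4 : NoFlagOrbitMatrix 4) (h3 : NoFlagOrbitMatrix 3) (h7 : NoFlagSevenOrbitMatrix) (h10 : NoFlagTenOrbitMatrix)
    (P L : Type) [Membership P L] [Fintype P] [Fintype L] [ProjectivePlane P L] (h12 : ProjectivePlane.order P L = 12)
    (G : Type) [Group G] [Fintype G] [MulAction G P] [MulAction G L] (hG : IsCollineationGroup G P L) :
    Fintype.card G = 1 :=
  card_collineationGroup_eq_one_v17 h2 h3E h4 h3 h7 h10 noCollineationOfOrderEleven noLiftData13 P L h12 G hG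

end Summit.Ventures.DiscreteObjects.PP12
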